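import Summits.Ventures.Crystal3D.Theorems.StickyWulffConstantCoaxialWallLawWordCell
import Summits.Ventures.Crystal3D.Theorems.StickyWulffConstantCoaxialWallLawFluxGap
import Summits.Ventures.Crystal3D.Theorems.StickyWulffConstantCoaxialWallLawInteriorLedger
import Summits.Ventures.Crystal3D.Theorems.StickyWulffConstantCoaxialWallLawHaggConst
import Summits.Ventures.Crystal3D.Theorems.StickyWulffConstantGenericWallFloorCoaxialIff
import Summits.Ventures.Crystal3D.Theorems.StickyWulffConstantGenericWallFloorSampleDeficitUpper
import Summits.Ventures.Crystal3D.Theorems.StickyWulffConstantGenericWallFloorRigidRung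
import Summits.Ventures.Crystal3D.Theorems.StickyWulffConstantNoReconstructionGainLatticeAdhesion
import HarnessLib

/-!
# The NET rung of `stub_coaxialTwoSlabAdhesion`: arbitrary fillings, every co-axial twin pair, NO residual

HONEST FRAMING. Part of the venture `Summits/Ventures/Crystal3D` (cell `crystal3d-full`), helper
`--supports` the crux `CoaxialWallLaw` (stmt-Ventures-19481, `route-Ventures-StickyWulffConstant`),
REGISTERED line `WallLedgerF` (planner cf-p1 gen 16), open stub `stub_coaxialTwoSlabAdhesion`.
RUNG CREDIT ONLY — this is NOT the stub: it is the stub's inequality, for the given co-axiality data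
`L, s₁, s₂, σ, σ'`, for ARBITRARY `1`-separated fillings `X` of the cell and every co-axial TWIN pair
(`A₁·Λ₀ ≠ A₂·Λ₀`, ANY inclination `θ = ∠(e₃, L e₃)`), with the crux's constant `½` replaced by `√6/34320`
and NO residual term; the kissing facts `KissingGap δ` / `KissingClassification δ` are taken BY NAME (inputs,
as everywhere on this line).  Brick W9c — the capstone of the v2 (NET) word automaton (memo
F-NET-AUTOMATON-v2, evidence on the crux item); it supersedes v1's `coaxialTwoSlabAdhesion_general_twin_fluxGap`
(residual `(1/26)·#FOREIGN`, regime `cos²θ ≥ 9/25`).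

**Theorem (`coaxialTwoSlabAdhesion_general_twin_net`).**  Under the crux's co-axiality data and
`A₁·Λ₀ ≠ A₂·Λ₀` there are `C` and `R₀ = 10` such that for every `h ≥ 0`, `ρ ≥ R₀`, every `1`-separated
`X` in the cell with the two complete slab samples `P₁ ⊆ X`, `P₂ ⊆ X ∖ P₁`:
`cross(P₁, X∖P₁) + cross(P₂, Y) ≤ D(Y) + (φ₁ + φ₂ − (√6/34320)·√(1 − ⟪L e₃, e₃⟫²)) π ρ² + C (1 + h) ρ`.

Proof.  As in v1 (`contactDeficiency_sdiff_split`, `affineSampleDeficit_upper`,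
`ledger_ge_faces_add_interior`), with the payers of the interior window now fed by the NET flux gap of the
word automaton (`wordNet_twin_payers_ge`): `2860·#{deg ≤ 11} ≥ √2 (α₁ − α₂⁺) π ρ² − O((1+h)ρ)` for the steep
far slot `u⋆` of the axis (`exists_far_slot_steep`: `α₁ = √(2/3) cos θ + δ⋆`, `α₂ = √(2/3) cos θ − δ⋆`,
`δ⋆ ≥ 0`, `sin θ ≤ 2√3 δ⋆`), and `α₁ − α₂⁺ ≥ δ⋆ ≥ sin θ/(2√3)`, so `√2 (α₁ − α₂⁺) ≥ (√6/6) sin θ`; the root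
direction rises for every `θ` (`α₁ > 0`: at `cos θ = 0`, `δ⋆ ≥ 1/(2√3)`).

WHAT THIS IS NOT: not the stub (translation pairs `A₁·Λ₀ = A₂·Λ₀` are not covered by the NET automaton yet;
constant `√6/34320 < ½`); F-C1 not moved.
-/

noncomputable section

namespace Summit.Ventures.Crystal3D.Theorems

open Summit.Ventures.Crystal3D Finset
open Literature.MathematicalPhysics.StatisticalMechanics (fccStacking barlowStacking IsHaggSeq
  contactDeficiency)
open scoped InnerProductSpace

open scoped Classical in
/-- **The NET rung of `stub_coaxialTwoSlabAdhesion` (general fillings, all twin pairs, no residual).**  See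
the module docstring. -/
theorem coaxialTwoSlabAdhesion_general_twin_net {δ : ℝ} (hg : KissingGap δ) (hc : KissingClassification δ)
    (A₁ : EuclideanSpace ℝ (Fin 3) ≃ₗᵢ[ℝ] EuclideanSpace ℝ (Fin 3)) (t₁ : EuclideanSpace ℝ (Fin 3))
    (A₂ : EuclideanSpace ℝ (Fin 3) ≃ₗᵢ[ℝ] EuclideanSpace ℝ (Fin 3)) (t₂ : EuclideanSpace ℝ (Fin 3))
    (L : EuclideanSpace ℝ (Fin 3) ≃ₗᵢ[ℝ] EuclideanSpace ℝ (Fin 3)) (s₁ s₂ : EuclideanSpace ℝ (Fin 3))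
    (σ σ' : ℤ → ℤ) (hσ : IsHaggSeq σ) (hσ' : IsHaggSeq σ')
    (hsub₁ : (fun p => A₁ p + t₁) '' fccStacking 1 (Real.sqrt (2 / 3)) ⊆
      (fun p => L p + s₁) '' barlowStacking 1 (Real.sqrt (2 / 3)) σ)
    (hsub₂ : (fun p => A₂ p + t₂) '' fccStacking 1 (Real.sqrt (2 / 3)) ⊆
      (fun p => L p + s₂) '' barlowStacking 1 (Real.sqrt (2 / 3)) σ')
    (htwin : A₁ '' fccStacking 1 (Real.sqrt (2 / 3)) ≠ A₂ '' fccStacking 1 (Real.sqrt (2 / 3))) :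
    ∃ C R₀ : ℝ, 1 ≤ R₀ ∧ ∀ h : ℝ, 0 ≤ h → ∀ ρ : ℝ, R₀ ≤ ρ →
      ∀ X P₁ P₂ : Finset (EuclideanSpace ℝ (Fin 3)),
      (∀ p ∈ X, ∀ q ∈ X, p ≠ q → 1 ≤ dist p q) → P₁ ⊆ X → P₂ ⊆ X \ P₁ →
      (∀ p ∈ X, -(2 * R₀) ≤ p 2 ∧ p 2 ≤ h + 2 * R₀ ∧ p 0 ^ 2 + p 1 ^ 2 ≤ ρ ^ 2) →
      (∀ p, p ∈ P₁ ↔ (p ∈ (fun q => A₁ q + t₁) '' fccStacking 1 (Real.sqrt (2 / 3)) ∧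
        -(2 * R₀) ≤ p 2 ∧ p 2 ≤ -R₀ ∧ p 0 ^ 2 + p 1 ^ 2 ≤ ρ ^ 2)) →
      (∀ p, p ∈ P₂ ↔ (p ∈ (fun q => A₂ q + t₂) '' fccStacking 1 (Real.sqrt (2 / 3)) ∧
        h + R₀ ≤ p 2 ∧ p 2 ≤ h + 2 * R₀ ∧ p 0 ^ 2 + p 1 ^ 2 ≤ ρ ^ 2)) →
      ((((P₁ ×ˢ (X \ P₁)).filter fun pq => dist pq.1 pq.2 = 1).card : ℕ) : ℝ) +
        ((((P₂ ×ˢ ((X \ P₁) \ P₂)).filter fun pq => dist pq.1 pq.2 = 1).card : ℕ) : ℝ) ≤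
        contactDeficiency ((X \ P₁) \ P₂) +
          (Real.sqrt 2 / 4 * ∑ᶠ w ∈ {w ∈ fccStacking 1 (Real.sqrt (2 / 3)) | ‖w‖ = 1},
              |⟪w, A₁.symm (EuclideanSpace.single (2 : Fin 3) (1 : ℝ))⟫_ℝ| +
            Real.sqrt 2 / 4 * ∑ᶠ w ∈ {w ∈ fccStacking 1 (Real.sqrt (2 / 3)) | ‖w‖ = 1},
              |⟪w, A₂.symm (EuclideanSpace.single (2 : Fin 3) (1 : ℝ))⟫_ℝ| -
            (Real.sqrt 6 / 34320 : ℝ) * Real.sqrt (1 - ⟪L (EuclideanSpace.single (2 : Fin 3) (1 : ℝ)),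
              (EuclideanSpace.single (2 : Fin 3) (1 : ℝ))⟫_ℝ ^ 2)) * Real.pi * ρ ^ 2 +
          C * (1 + h) * ρ := by
  set e₃ : EuclideanSpace ℝ (Fin 3) := EuclideanSpace.single (2 : Fin 3) (1 : ℝ) with he₃
  set RL : EuclideanSpace ℝ (Fin 3) ≃ₗᵢ[ℝ] EuclideanSpace ℝ (Fin 3) :=
    (ℝ ∙ EuclideanSpace.single (2 : Fin 3) (1 : ℝ)).reflection.trans L with hRL
  have hr : 0 < Real.sqrt (2 / 3) := Real.sqrt_pos.2 (by norm_num)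
  have he₃1 : ‖e₃‖ = 1 := by rw [he₃, PiLp.norm_single, norm_one]
  obtain ⟨C₁, hC₁⟩ := affineSampleDeficit_upper A₁ t₁ 10 (by norm_num)
  obtain ⟨C₂, hC₂⟩ := affineSampleDeficit_upper A₂ t₂ 10 (by norm_num)
  -- the pair is a twin pair in the frame: `σ 0 ≠ σ' 0`
  have htw : σ 0 ≠ σ' 0 := by
    intro heq
    obtain ⟨-, e₁⟩ := linear_image_eq_frame_of_subset A₁ L t₁ s₁ hσ hsub₁
    obtain ⟨-, e₂⟩ := linear_image_eq_frame_of_subset A₂ L t₂ s₂ hσ' hsub₂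
    exact htwin (by rw [e₁, e₂, heq])
  -- normal form: the grains are `F false·Λ₀ + s₁`, `F true·Λ₀ + s₂` with `{F false, F true} = {L, L∘R}`
  have hnorm : ∃ F : Bool → (EuclideanSpace ℝ (Fin 3) ≃ₗᵢ[ℝ] EuclideanSpace ℝ (Fin 3)),
      ((F false = L ∧ F true = RL) ∨ (F false = RL ∧ F true = L)) ∧
      (fun q => A₁ q + t₁) '' fccStacking 1 (Real.sqrt (2 / 3)) =
        (fun q => F false q + s₁) '' fccStacking 1 (Real.sqrt (2 / 3)) ∧
      (fun q => A₂ q + t₂) '' fccStacking 1 (Real.sqrt (2 / 3)) =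
        (fun q => F true q + s₂) '' fccStacking 1 (Real.sqrt (2 / 3)) := by
    rcases hσ 0 with h1 | hm1
    · have hm1' : σ' 0 = -1 := (hσ' 0).resolve_left fun h' => htw (h1.trans h'.symm)
      have e₁ := coaxial_frame_eq_fcc_of_one A₁ t₁ L s₁ hσ hsub₁ h1
      obtain ⟨e₂, -⟩ := coaxial_frame_eq_fcc_of_neg_one A₂ t₂ L s₂ hσ' hsub₂ hm1'
      exact ⟨fun c => cond c RL L, Or.inl ⟨rfl, rfl⟩, e₁, e₂⟩
    · have h1' : σ' 0 = 1 := (hσ' 0).resolve_right fun h' => htw (hm1.trans h'.symm)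
      obtain ⟨e₁, -⟩ := coaxial_frame_eq_fcc_of_neg_one A₁ t₁ L s₁ hσ hsub₁ hm1
      have e₂ := coaxial_frame_eq_fcc_of_one A₂ t₂ L s₂ hσ' hsub₂ h1'
      exact ⟨fun c => cond c L RL, Or.inr ⟨rfl, rfl⟩, e₁, e₂⟩
  obtain ⟨F, hF, e₁, e₂⟩ := hnorm
  -- the axis, oriented upwards: `n = ±L e₃` with `⟪n, e₃⟫ = |cos θ| ≥ 0`
  obtain ⟨n, hn, hcn⟩ : ∃ n : EuclideanSpace ℝ (Fin 3), (n = L e₃ ∨ n = -L e₃) ∧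
      ⟪n, e₃⟫_ℝ = |⟪L e₃, e₃⟫_ℝ| := by
    by_cases h0 : 0 ≤ ⟪L e₃, e₃⟫_ℝ
    · exact ⟨L e₃, Or.inl rfl, (abs_of_nonneg h0).symm⟩
    · refine ⟨-L e₃, Or.inr rfl, ?_⟩
      rw [inner_neg_left, abs_of_neg (lt_of_not_ge h0)]
  have hn1 : ‖n‖ = 1 := by
    rcases hn with h' | h'
    · rw [h', LinearIsometryEquiv.norm_map, he₃1]
    · rw [h', norm_neg, LinearIsometryEquiv.norm_map, he₃1]
  have hc0 : 0 ≤ ⟪n, e₃⟫_ℝ := by rw [hcn]; exact abs_nonneg _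
  have hcsq : ⟪n, e₃⟫_ℝ ^ 2 = ⟪L e₃, e₃⟫_ℝ ^ 2 := by rw [hcn, sq_abs]
  have hrc : 0 ≤ Real.sqrt (2 / 3) * ⟪n, e₃⟫_ℝ := mul_nonneg hr.le hc0
  -- menu of the frames along the axis
  have hax : ∀ c w, ⟪F c w, L e₃⟫_ℝ = w 2 := by
    intro c w
    rcases hF with ⟨h0, h1⟩ | ⟨h0, h1⟩ <;> cases c <;> simp only [h0, h1]
    · exact inner_frame_axis L w
    · exact inner_twinFrame_axis L w
    · exact inner_twinFrame_axis L w
    · exact inner_frame_axis L w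
  have hmenu0 : ∀ w ∈ fccSlots, ⟪F false w, n⟫_ℝ = 0 ∨ ⟪F false w, n⟫_ℝ = Real.sqrt (2 / 3) ∨
      ⟪F false w, n⟫_ℝ = -Real.sqrt (2 / 3) := by
    intro w hw
    have h : ⟪F false w, n⟫_ℝ = w 2 ∨ ⟪F false w, n⟫_ℝ = -w 2 := by
      rcases hn with h' | h'
      · exact Or.inl (by rw [h', hax])
      · exact Or.inr (by rw [h', inner_neg_right, hax])
    rcases h with h | h <;> rcases slot_apply_two_cases hw with h' | h' | h' <;> rw [h, h']
    · exact Or.inl rfl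
    · exact Or.inr (Or.inl rfl)
    · exact Or.inr (Or.inr rfl)
    · exact Or.inl neg_zero
    · exact Or.inr (Or.inr rfl)
    · exact Or.inr (Or.inl (neg_neg _))
  -- the far frame of the bottom grain and its steep far slot `u`
  obtain ⟨u₁, hu₁, u₂, hu₂, u₃, hu₃, hn₁, hn₂, hn₃, i12, i13, i23, -, -⟩ :=
    exists_far_frame (F false) hn1 hmenu0
  obtain ⟨u, hu, hδ0, hSδ⟩ := exists_far_slot_steep (F false) hn1 he₃1 hu₁ hu₂ hu₃ hn₁ hn₂ hn₃ i12 i13 i23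
  obtain ⟨huS, hun⟩ : u ∈ fccSlots ∧ ⟪F false u, n⟫_ℝ = Real.sqrt (2 / 3) := by
    simp only [mem_insert, mem_singleton] at hu
    rcases hu with rfl | rfl | rfl
    · exact ⟨hu₁, hn₁⟩
    · exact ⟨hu₂, hn₂⟩
    · exact ⟨hu₃, hn₃⟩
  set dd : ℝ := ⟪F false u, e₃⟫_ℝ - Real.sqrt (2 / 3) * ⟪n, e₃⟫_ℝ with hdd
  -- the two designated slots: `α₁ = (F false u)₂ = √(2/3) cos θ + δ⋆`, `α₂ = (F true u)₂ = √(2/3) cos θ − δ⋆`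
  have h2a : (F false u) 2 = ⟪F false u, e₃⟫_ℝ := apply_two_eq_inner_e₃ _
  have hn2 : n 2 = ⟪n, e₃⟫_ℝ := apply_two_eq_inner_e₃ _
  have hα₁eq : (F false u) 2 = Real.sqrt (2 / 3) * ⟪n, e₃⟫_ℝ + dd := by rw [h2a, hdd]; ring
  have key : F true u = F false (-u) - (2 * ⟪F false (-u), n⟫_ℝ) • n := by
    rcases hF with ⟨h0, h1⟩ | ⟨h0, h1⟩
    · rw [h0, h1]
      have := twinFrame_neg_eq L hn (-u)
      rwa [neg_neg] at this
    · rw [h0, h1]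
      have := frame_neg_eq L hn (-u)
      rwa [neg_neg] at this
  have hmirror : F true u = -F false u + (2 * ⟪F false u, n⟫_ℝ) • n := by
    rw [key, map_neg, inner_neg_left, mul_neg, neg_smul, sub_neg_eq_add]
  have hα₂eq : (F true u) 2 = Real.sqrt (2 / 3) * ⟪n, e₃⟫_ℝ - dd := by
    have h1 : (F true u) 2 = -(F false u) 2 + 2 * ⟪F false u, n⟫_ℝ * n 2 := by
      rw [hmirror]
      simp only [PiLp.add_apply, PiLp.neg_apply, PiLp.smul_apply, smul_eq_mul]
    rw [h1, hun, hn2, h2a, hdd]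
    ring
  -- the root direction rises for every inclination
  have hα₁pos : 0 < (F false u) 2 := by
    rw [hα₁eq]
    rcases lt_or_eq_of_le hc0 with hcpos | hc00
    · have : 0 < Real.sqrt (2 / 3) * ⟪n, e₃⟫_ℝ := mul_pos hr hcpos
      linarith only [this, hδ0]
    · -- `cos θ = 0`: `1 = sin θ ≤ 2√3 δ⋆`
      rw [← hc00] at hSδ
      simp only [ne_eq, OfNat.ofNat_ne_zero, not_false_eq_true, zero_pow, sub_zero, Real.sqrt_one] at hSδ
      have h3 : 0 < Real.sqrt 3 := Real.sqrt_pos.2 (by norm_num)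
      have : 0 < dd := by
        by_contra hle
        push Not at hle
        nlinarith only [hSδ, hle, h3]
      rw [← hc00, mul_zero, zero_add]; exact this
  -- the NET gap: `α₁ − max α₂ 0 ≥ δ⋆`
  have hgap : dd ≤ (F false u) 2 - max ((F true u) 2) 0 := by
    have hm : max ((F true u) 2) 0 ≤ Real.sqrt (2 / 3) * ⟪n, e₃⟫_ℝ :=
      max_le (by rw [hα₂eq]; linarith only [hδ0]) hrc
    rw [hα₁eq]; linarith only [hm]
  -- the flux gap beats `(√6/6) sin θ`
  have h66 : Real.sqrt 6 / 6 * Real.sqrt (1 - ⟪L e₃, e₃⟫_ℝ ^ 2) ≤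
      Real.sqrt 2 * ((F false u) 2 - max ((F true u) 2) 0) := by
    have hs6 : Real.sqrt 6 = Real.sqrt 2 * Real.sqrt 3 := by
      rw [← Real.sqrt_mul (by norm_num : (0 : ℝ) ≤ 2)]; norm_num
    have hs3 : Real.sqrt 3 * Real.sqrt 3 = 3 := Real.mul_self_sqrt (by norm_num)
    have h2 : 0 ≤ Real.sqrt 2 := Real.sqrt_nonneg _
    rw [hcsq] at hSδ
    calc Real.sqrt 6 / 6 * Real.sqrt (1 - ⟪L e₃, e₃⟫_ℝ ^ 2)
        = Real.sqrt 2 * Real.sqrt 3 / 6 * Real.sqrt (1 - ⟪L e₃, e₃⟫_ℝ ^ 2) := by rw [hs6]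
      _ ≤ Real.sqrt 2 * Real.sqrt 3 / 6 * (2 * Real.sqrt 3 * dd) :=
          mul_le_mul_of_nonneg_left hSδ (by positivity)
      _ = Real.sqrt 2 * dd * (Real.sqrt 3 * Real.sqrt 3 / 3) := by ring
      _ = Real.sqrt 2 * dd := by rw [hs3]; ring
      _ ≤ Real.sqrt 2 * ((F false u) 2 - max ((F true u) 2) 0) := mul_le_mul_of_nonneg_left hgap h2
  -- the constant
  have hCE0 : (0 : ℝ) ≤ 12 * Real.sqrt 2 * Real.pi + 2 * Real.sqrt 2 * Real.pi * ((10 - 1) / 2 + 4) +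
      36 * 10 + 55440 := by norm_num; positivity
  have hCK0 : (0 : ℝ) ≤ Real.sqrt 2 * Real.pi * ((10 - 1) / 2 + 4) ^ 2 / max ((F true u) 2) 0 :=
    div_nonneg (by positivity) (le_max_right _ _)
  refine ⟨|C₁| + |C₂| + (240 * Real.sqrt 2 * Real.pi + 3120 * (4 * 10 + 2)) / 2 +
    (12 * Real.sqrt 2 * Real.pi + 2 * Real.sqrt 2 * Real.pi * ((10 - 1) / 2 + 4) + 36 * 10 + 55440) / 5720 +
    Real.sqrt 2 * Real.pi * ((10 - 1) / 2 + 4) ^ 2 / max ((F true u) 2) 0 / 5720, 10, by norm_num, ?_⟩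
  intro h hh ρ hρ X P₁ P₂ hX hP₁X hP₂X₁ hcyl hP₁ hP₂
  set φ₁ : ℝ := Real.sqrt 2 / 4 * ∑ᶠ w ∈ {w ∈ fccStacking 1 (Real.sqrt (2 / 3)) | ‖w‖ = 1},
      |⟪w, A₁.symm e₃⟫_ℝ| with hφ₁
  set φ₂ : ℝ := Real.sqrt 2 / 4 * ∑ᶠ w ∈ {w ∈ fccStacking 1 (Real.sqrt (2 / 3)) | ‖w‖ = 1},
      |⟪w, A₂.symm e₃⟫_ℝ| with hφ₂
  have hP₂X : P₂ ⊆ X := hP₂X₁.trans sdiff_subset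
  have hρ0 : (0 : ℝ) ≤ ρ := by linarith
  -- (1) the two slab samples from above
  have hD₁ := hC₁ (-(2 * 10)) (-10) (by norm_num) ρ hρ P₁ hP₁
  have hD₂ := hC₂ (h + 10) (h + 2 * 10) (by ring) ρ hρ P₂ hP₂
  -- (2) the interior ledger
  have hled := ledger_ge_faces_add_interior A₁ t₁ A₂ t₂ X P₁ P₂ 10 h ρ le_rfl hh hρ hX hcyl hP₁X hP₂X
    hP₁ hP₂
  have hf₁ : Real.sqrt 2 / 4 * ∑ w ∈ fccSlots, |⟪A₁ w, e₃⟫_ℝ| = φ₁ := by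
    rw [hφ₁, finsum_unit_fcc_symm_eq_sum_slots]
  have hf₂ : Real.sqrt 2 / 4 * ∑ w ∈ fccSlots, |⟪A₂ w, e₃⟫_ℝ| = φ₂ := by
    rw [hφ₂, finsum_unit_fcc_symm_eq_sum_slots]
  rw [hf₁, hf₂, ← two_mul_contactDeficiency_eq_sum X] at hled
  -- (3) the payers of the interior window, fed by the NET flux gap
  have hP₁' := hP₁
  have hP₂' := hP₂
  simp only [e₁, e₂] at hP₁' hP₂'
  have hpay := wordNet_twin_payers_ge hg hc L F hF hn huS hun hα₁pos s₁ s₂ X P₁ P₂ 10 h ρ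
    le_rfl hh hρ hX hcyl hP₁X hP₂X hP₁' hP₂'
  have hPAY : ((X.filter fun z => (X.filter fun q => dist z q = 1).card ≤ 11 ∧
        -10 - 2 ≤ z 2 ∧ z 2 ≤ h + 10 + 2).card : ℝ) ≤
      ((X.filter fun y => (X.filter fun q => dist y q = 1).card ≠ 12 ∧
        -10 - 2 ≤ y 2 ∧ y 2 ≤ h + 10 + 2).card : ℝ) := by
    exact_mod_cast card_le_card fun z hz => by
      rw [mem_filter] at hz ⊢
      exact ⟨hz.1, by have := hz.2.1; omega, hz.2.2⟩
  -- (4) the two splits of the skeleton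
  have hs₁ := contactDeficiency_sdiff_split hP₁X
  have hs₂ := contactDeficiency_sdiff_split hP₂X₁
  -- (5) assemble
  have hπρ : 0 ≤ Real.pi * ρ ^ 2 := by positivity
  have hflux : Real.sqrt 6 / 6 * Real.sqrt (1 - ⟪L e₃, e₃⟫_ℝ ^ 2) * (Real.pi * ρ ^ 2) ≤
      Real.sqrt 2 * ((F false u) 2 - max ((F true u) 2) 0) * (Real.pi * ρ ^ 2) :=
    mul_le_mul_of_nonneg_right h66 hπρ
  have ha : C₁ * ρ ≤ |C₁| * (1 + h) * ρ := by
    have h1 : C₁ * ρ ≤ |C₁| * ρ := mul_le_mul_of_nonneg_right (le_abs_self _) hρ0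
    have h2 : 0 ≤ |C₁| * h * ρ := by positivity
    linarith only [h1, h2]
  have hb : C₂ * ρ ≤ |C₂| * (1 + h) * ρ := by
    have h1 : C₂ * ρ ≤ |C₂| * ρ := mul_le_mul_of_nonneg_right (le_abs_self _) hρ0
    have h2 : 0 ≤ |C₂| * h * ρ := by positivity
    linarith only [h1, h2]
  have hCE : (12 * Real.sqrt 2 * Real.pi + 2 * Real.sqrt 2 * Real.pi * ((10 - 1) / 2 + 4) + 36 * 10 + 55440) * ρ ≤
      (12 * Real.sqrt 2 * Real.pi + 2 * Real.sqrt 2 * Real.pi * ((10 - 1) / 2 + 4) + 36 * 10 + 55440) *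
        (1 + h) * ρ := by
    have := mul_nonneg (mul_nonneg hCE0 hh) hρ0
    linarith only [this]
  have h1hρ : (1 : ℝ) ≤ (1 + h) * ρ := by
    have := mul_nonneg hh hρ0
    linarith only [this, hρ]
  have hCK : Real.sqrt 2 * Real.pi * ((10 - 1) / 2 + 4) ^ 2 / max ((F true u) 2) 0 ≤
      Real.sqrt 2 * Real.pi * ((10 - 1) / 2 + 4) ^ 2 / max ((F true u) 2) 0 * (1 + h) * ρ := by
    have := mul_le_mul_of_nonneg_left h1hρ hCK0
    linarith only [this]
  -- name the two counts
  set PAY : Finset (EuclideanSpace ℝ (Fin 3)) := X.filter fun z => (X.filter fun q => dist z q = 1).card ≤ 11 ∧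
    -10 - 2 ≤ z 2 ∧ z 2 ≤ h + 10 + 2
  set PAY' : Finset (EuclideanSpace ℝ (Fin 3)) := X.filter fun y => (X.filter fun q => dist y q = 1).card ≠ 12 ∧
    -10 - 2 ≤ y 2 ∧ y 2 ≤ h + 10 + 2
  have t1 : ((((P₁ ×ˢ (X \ P₁)).filter fun pq => dist pq.1 pq.2 = 1).card : ℕ) : ℝ) +
      ((((P₂ ×ˢ ((X \ P₁) \ P₂)).filter fun pq => dist pq.1 pq.2 = 1).card : ℕ) : ℝ) =
      contactDeficiency P₁ + contactDeficiency P₂ + contactDeficiency ((X \ P₁) \ P₂) -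
        contactDeficiency X := by linarith only [hs₁, hs₂]
  have t2 : Real.sqrt 6 / 6 * Real.sqrt (1 - ⟪L e₃, e₃⟫_ℝ ^ 2) * (Real.pi * ρ ^ 2) -
      (12 * Real.sqrt 2 * Real.pi + 2 * Real.sqrt 2 * Real.pi * ((10 - 1) / 2 + 4) + 36 * 10 + 55440) * ρ -
      Real.sqrt 2 * Real.pi * ((10 - 1) / 2 + 4) ^ 2 / max ((F true u) 2) 0 ≤
      2860 * (PAY'.card : ℝ) := by
    linarith only [hpay, hflux, hPAY]
  have t3 : 2 * φ₁ * Real.pi * ρ ^ 2 + 2 * φ₂ * Real.pi * ρ ^ 2 + (PAY'.card : ℝ) -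
      (240 * Real.sqrt 2 * Real.pi + 3120 * (4 * 10 + 2)) * (1 + h) * ρ ≤ 2 * contactDeficiency X := by
    linarith only [hled]
  have t4 : contactDeficiency P₁ ≤ 2 * φ₁ * Real.pi * ρ ^ 2 + C₁ * ρ := hD₁
  have t5 : contactDeficiency P₂ ≤ 2 * φ₂ * Real.pi * ρ ^ 2 + C₂ * ρ := hD₂
  linarith only [t1, t2, t3, t4, t5, ha, hb, hCE, hCK]

end Summit.Ventures.Crystal3D.Theorems

end
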